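import Summits.QuantumFields.YangMills.Theorems.BalabanUVNodesN15TwoSpacingGluingCurvedKnit
import Summits.QuantumFields.YangMills.Theorems.BalabanUVNodesN15TwoSpacingGluingCurvedKnitFine
import Summits.QuantumFields.YangMills.Theorems.BalabanUVNodesN15CurvedLocalCoefLettersOfReg335UN
import HarnessLib

/-!
# THE GLUING STEP AT TWO LATTICE SPACINGS — (Λ2a) THE LIVE-`U` KNIT AT THE COVER IN THE GLOBAL SMALL-FIELD GAUGE, EVERY ROW PRODUCED:
# the glued inverse of `Δ_{Ad e^{iηA}} + N_L ⊗ 1` for a Hermitian bond field `A` with Bałaban's (3.35) letters GLOBAL (dag-n15-c g16, FILE 129; N15 = NE2, s1 «background-layer OPERATOR ingredient»)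

Cell `pub-ymgap`, seat `pub-ymgap-dag-n15-c` (R134 (a); HUMAN RULING D-0062), generation 16.  `bears_on: R4∕N15 · K3⁸ SpineGivenEndpointR13SepCoPHV (stmt-QuantumFields-27366)`.
Filed `--kind proof --supports stmt-QuantumFields-27366 --as helper` — COUNT-NEUTRAL.  Theorems only; 0 `def`, 0 `sorry`.  Imports BY NAME FILE 124 `…TwoSpacingGluingCurvedKnitFine`
(`uN_cvGlued'_spec`; through it FILE 120 `uN_cvGlued_spec`) and dag-n15-w2 g6 `…CurvedLocalCoefLettersOfReg335UN` (`uN_localCoefLetters_of_gauge335`; through it lit-balaban r06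
`B9Eq39Adjoint.fluct` = «U′ = e^{iηA}», `B9Eq3117Current.gaugeTr` (3.28)).  Nothing in the tree is modified.

WHY (located, [Balaban1985BackgroundPropagators] pp. 392–395 re-read).  FILES 120∕124 (the live-`U` knit at the cover, both grids) display SEVEN rows: the gauges' unitarity `hu`, the
conjugation law `hP` of Bałaban's summand `P` in the per-cube gauges (`M_{W_k}PM_{W_kᵀ} = N_L ⊗ 1 − N_V k`), the (3.35) row letters `hCloc`∕`hAloc` of the transformed bond variables on
the cut boxes, and `N_V`'s cut∕far letters `hNVcut`∕`hfarN`.  Bałaban's own summand `P(U) = Q*(U)aQ(U) + D_U R(U) D*_U` ((3.26) p. 395) is COVARIANT — `W_kP(U)W_kᵀ = P(U^{w_k})` — and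
NONLOCAL through the projection `R(U)` ((3.25), containing `G′(U)` itself); with the cover's FLAT nonlocal part `N_L = (aQ*Q − ∂Π∂*) ⊗ 1_ι` ([B4-I] (1.69)) in the role of `P` the only
gauges compatible with `hP` are GLOBAL ones, and the honest sub-class of (3.35) is «`u ≡ 1` on the whole torus»: a HERMITIAN bond field `A` with `‖A_μ(x)‖ < C∕ξ`, `‖η⁻¹∇^ηA‖ < C∕ξ²`
everywhere, `U = e^{iηA}`.  For this class EVERY displayed row is produced here: `hu` (`w ≡ 1`), `hP` (`P := N_L ⊗ 1`, `N_V := 0`: the gauge sandwiches at `w ≡ 1` are the identity),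
`hCloc`∕`hAloc` (dag-n15-w2's `uN_localCoefLetters_of_gauge335` at `u = w ≡ 1`, `Q = univ`), `hNVcut`∕`hfarN` (the zero operator).

WHAT.
* §1 `fluct_mem_unitaryGroup_of_isHermitian` (`e^{iηA}` is unitary for Hermitian `A`: Mathlib `NormedSpace.exp_mem_unitary_of_mem_skewAdjoint`), `gaugeTr_one` (`U^1 = U`),
  `mmulOp_coordMat_conj_one`∕`_transpose` (`M_{W} = M_{Wᵀ} = id` at `w ≡ 1`: n15-w2 `coordMat_conj_one` + `mmulOp_one`), `conj_cvNL_one`∕`conj_cvNL'_one` (120's∕124's `hP` at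
  `P := N_L ⊗ 1`, `N_V := 0`), `hasMaj_sandwich_zero` (the `N_V` rows at `N_V ≡ 0`: r1 `hasMaj_zero_of_nonneg`).
* §2 ★ `sf_localCoefLetters` — the (3.35) row letters of the exact coefficients `tCoefC`∕`tCoefA` of `gaugePair τ (coordMat e Ad_{e^{iηA}})` at EVERY site from the GLOBAL letters of a
  Hermitian `A` (n15-w2 `uN_localCoefLetters_of_gauge335` at `u = w ≡ 1`, `Q = univ`), in 120's literal row shape (`1·U·1ᴴ`).
* §3 ★★★ `sf_cvGlued_spec` — FILE 120 `uN_cvGlued_spec` WITH ALL SEVEN DISPLAYED ROWS DISCHARGED: for odd `L ≥ 7`, `a > 0`, `ι`: `∃ δ w₀ R₀ B > 0` such that on every doubled torus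
  `2L·L^m` of the cover (`k ≥ 1`, `L^m ≥ w₀`), for trace-form coordinates `e` of `𝔲(m)`, EVERY Hermitian bond field `A` with the global letters (`ξ > 0`, `C ≥ 0`) whose two explicit
  (3.35) row bounds are `≤ r_V` with `r_V(1 + |J ⊕ J|) ≤ R₀`: the glued operator `cvGlued … 1 e^{iηA} (N_L ⊗ 1) 0` is `≤ B·e^{−(δ∕16)|y−y′|_T}` blockwise AND is the two-sided inverse of
  `Δ_{Ad e^{iηA}} + N_L ⊗ 1` (`covLapM` of the transporters `coordMat e Ad_{e^{iηA}}` plus the flat nonlocal part) — hypothesis = the small-field letters of `A` ONLY;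
  ★★★ `sf_cvGlued'_spec` — the same on the fine grid of the cover (FILE 124), constants uniform in the refinement `r`.

HONEST FRAMING ∕ LIMITS.  Bookkeeping over LANDED theorems (two `obtain`s, one application each) + finite-dimensional algebra; MODEL operator: the covariant Laplacian (3.50) of the
transporters `Ad_{e^{iηA}}` componentwise in the colour PLUS the FLAT nonlocal part of [B4-I] (1.69) — NOT Bałaban's `Δ_a(U)` of (3.26) (no covariant averaging `Q(U)`, no covariant
projection `R(U)`, no plaquette coupling `Δ′`); MODEL carriers (finite doubled torus, flat cubes by images); the class is the GLOBAL-gauge sub-case of (3.35) (no large pure-gauge part);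
constants crude.  The SHAPE of [B9] Thm 3.1 («G(U) exists and decays for U in the class, M ≥ M₁»), not the printed theorem; nothing of [B5]∕[B6]∕[B9] asserted.  NE2⁺ NOT PRINTED, NOT
proved (one grid each: no η-defect here — the sequel); N15 NOT discharged; K3⁸ OPEN, skeleton v6 untouched (0∕2); counts of record UNMOVED (typed 28∕28 · discharged 5∕27 · A 5∕28); one
finite 𝕋⁴ at fixed ε — NOT infinite volume, NOT OS on ℝ⁴, NOT a mass gap, NOT Clay; R4 closes the conditional finite-𝕋⁴ rung `BalabanLadder.UV` only.  Restate-immune (no Theses import).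
-/

noncomputable section

open scoped BigOperators Matrix

namespace Summit.QuantumFields.YangMills.BalabanUVNodes.N15.Gluing

open Real
open Literature.MathematicalPhysics.QuantumFieldTheory.Balaban1983to89
open Literature.MathematicalPhysics.QuantumFieldTheory.Balaban1983to89.B11SectG (BlockNorm HasMaj)
open Literature.MathematicalPhysics.QuantumFieldTheory.Balaban1983to89.B6Prop26Gluing (mulOp)
open Literature.MathematicalPhysics.QuantumFieldTheory.Balaban1983to89.B6UnitTorusCarrier (unitTorusGeo unitTorusGeo_dist_nonneg)
open Literature.MathematicalPhysics.QuantumFieldTheory.Balaban1983to89.B9Eq39Adjoint (covD fluct)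
open Literature.MathematicalPhysics.QuantumFieldTheory.Balaban1983to89.B9Eq3117Current (gaugeTr)
open Literature.MathematicalPhysics.QuantumFieldTheory.King1986.Torus (blockOf)
open Literature.Barriers.QuantumFields (traceForm)
open Summit.QuantumFields.YangMills.BalabanUVNodes.N15.BackgroundLayer (covLapM tCoefA tCoefC)
open Summit.QuantumFields.YangMills.BalabanUVNodes.N15.VectorPiece (bshiftEquiv)
open Summit.QuantumFields.YangMills.BalabanUVNodes.N15.MatrixSpecies (mmulOp coordMat basisConst liftBlk)
open Summit.QuantumFields.YangMills.BalabanUVNodes.N15.CurvedSpecies (gaugePair uN_localCoefLetters_of_gauge335 coordMat_conj_one mmulOp_one val_fluct)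

variable {d : ℕ}

/-! ## §1 The rows of 120∕124 at `w ≡ 1`, `P := N_L ⊗ 1`, `N_V := 0` -/

section Unitary

open scoped Matrix.Norms.L2Operator

variable {mm : Type} [Fintype mm] [DecidableEq mm]

/-- `e^{iηA(b)}` is UNITARY for a Hermitian `A(b)` (`iηA(b)` is skew-adjoint; Mathlib `NormedSpace.exp_mem_unitary_of_mem_skewAdjoint`). [folklore] -/
theorem fluct_mem_unitaryGroup_of_isHermitian {J X : Type} (η : ℝ) {A : J → X → Matrix mm mm ℂ} (hA : ∀ μ x, (A μ x)ᴴ = A μ x) (μ : J) (x : X) :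
    (fluct η A μ x : Matrix mm mm ℂ) ∈ Matrix.unitaryGroup mm ℂ := by
  letI : NormedAlgebra ℚ (Matrix mm mm ℂ) := NormedAlgebra.restrictScalars ℚ ℂ (Matrix mm mm ℂ)
  have hskew : ((Complex.I * η : ℂ)) • A μ x ∈ skewAdjoint (Matrix mm mm ℂ) := by
    rw [skewAdjoint.mem_iff, Matrix.star_eq_conjTranspose, Matrix.conjTranspose_smul, hA μ x, ← neg_smul]
    congr 1
    simp only [star_mul', Complex.star_def, Complex.conj_I, Complex.conj_ofReal, neg_mul]
  rw [val_fluct]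
  exact NormedSpace.exp_mem_unitary_of_mem_skewAdjoint hskew

end Unitary

section Rows

open scoped Matrix.Norms.Frobenius

variable {mm : Type} [Fintype mm] [DecidableEq mm]

/-- `U^1 = U` (the trivial gauge transformation). [cite: Balaban1985BackgroundPropagators, (3.28) p.395] -/
theorem gaugeTr_one {𝔸 S J : Type} [Ring 𝔸] (T : J → Equiv.Perm S) (U : J → S → 𝔸ˣ) (μ : J) (z : S) :
    gaugeTr T (fun _ => (1 : 𝔸ˣ)) U μ z = U μ z := by
  simp only [gaugeTr, inv_one, one_mul, mul_one]

variable {ι : Type} [Fintype ι] [DecidableEq ι] (e : Matrix mm mm ℂ ≃L[ℝ] (ι → ℝ))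

/-- At `w ≡ 1` the gauge sandwich `M_{W}` is the identity. [folklore] -/
theorem mmulOp_coordMat_conj_one {X : Type} :
    mmulOp (fun _ : X => coordMat e (ContinuousLinearMap.mulLeftRight ℝ (Matrix mm mm ℂ) (1 : Matrix mm mm ℂ) (1 : Matrix mm mm ℂ)ᴴ)) = LinearMap.id := by
  simp only [coordMat_conj_one, mmulOp_one]

/-- … and so is `M_{Wᵀ}`. [folklore] -/
theorem mmulOp_coordMat_conj_one_transpose {X : Type} :
    mmulOp (fun _ : X => (coordMat e (ContinuousLinearMap.mulLeftRight ℝ (Matrix mm mm ℂ) (1 : Matrix mm mm ℂ) (1 : Matrix mm mm ℂ)ᴴ))ᵀ) = LinearMap.id := by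
  simp only [coordMat_conj_one, Matrix.transpose_one, mmulOp_one]

/-- 120's∕124's `hP` row at `w ≡ 1`, `P := N`, `N_V := 0`: `M_W N M_{Wᵀ} = N − 0`. [folklore] -/
theorem conj_one_eq_sub_zero {X : Type} (N : (X × ι → ℝ) →ₗ[ℝ] (X × ι → ℝ)) :
    mmulOp (fun _ : X => coordMat e (ContinuousLinearMap.mulLeftRight ℝ (Matrix mm mm ℂ) (1 : Matrix mm mm ℂ) (1 : Matrix mm mm ℂ)ᴴ)) ∘ₗ N ∘ₗ
        mmulOp (fun _ : X => (coordMat e (ContinuousLinearMap.mulLeftRight ℝ (Matrix mm mm ℂ) (1 : Matrix mm mm ℂ) (1 : Matrix mm mm ℂ)ᴴ))ᵀ) = N - 0 := by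
  rw [mmulOp_coordMat_conj_one, mmulOp_coordMat_conj_one_transpose, LinearMap.id_comp, LinearMap.comp_id, sub_zero]

omit [DecidableEq ι] in
/-- The `N_V` rows at `N_V ≡ 0`: a sandwich of the zero operator has every majorant `c·e^{−δd}` with `c ≥ 0`. [folklore] -/
theorem hasMaj_sandwich_zero {g : B6.Geometry} {F₁ F₂ : Type} [AddCommGroup F₁] [Module ℝ F₁] [AddCommGroup F₂] [Module ℝ F₂] (b₁ : BlockNorm g F₁) (b₂ : BlockNorm g F₂)
    (S : F₂ →ₗ[ℝ] F₂) (T : F₁ →ₗ[ℝ] F₁) {c δ : ℝ} (hc : 0 ≤ c) (dist : g.Site → g.Site → ℝ) :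
    HasMaj b₁ b₂ (S ∘ₗ (0 : F₁ →ₗ[ℝ] F₂) ∘ₗ T) (fun y y' => c * Real.exp (-(δ * dist y y'))) := by
  intro y' f _ y
  rw [LinearMap.zero_comp, LinearMap.comp_zero, LinearMap.zero_apply, b₂.loc_zero]
  exact mul_nonneg (mul_nonneg hc (Real.exp_nonneg _)) (b₁.loc_nonneg _ _)

end Rows

/-! ## §2 The (3.35) row letters of the exact coefficients at every site, from the GLOBAL letters of a Hermitian `A` -/

section Letters

open scoped Matrix.Norms.L2Operator

variable {mm : Type} [Fintype mm] [DecidableEq mm] [Nonempty mm] {ι : Type} [Fintype ι] [DecidableEq ι] (e : Matrix mm mm ℂ ≃L[ℝ] (ι → ℝ))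
variable {X J : Type} [Fintype J] (τ : J → X ≃ X)

/-- ★ **THE ROW LETTERS AT EVERY SITE IN THE GLOBAL GAUGE** (dag-n15-w2 `uN_localCoefLetters_of_gauge335` at `u = w ≡ 1`, `Q = univ`): trace-form-orthonormal `e`; a Hermitian bond field
`A` with `‖A_μ(z)‖ < C∕ξ` and `‖η⁻¹∇^η_μA_ν(z)‖ < C∕ξ²` at every site (`η, ξ > 0`, `C ≥ 0`); `U = e^{iηA}`.  Then at every `x`, in 120's literal shape (`1·U_μ·1ᴴ`):
`Σ_j|tCoefA η (gaugePair τ S) j′ x i j| ≤ |ι|·p` and `Σ_j|tCoefC η (gaugePair τ S) x i j| ≤ |ι||J|(|ι|p² + q)`, `S_μ = coordMat e Ad_{U_μ}`, `p = κ_e·2√m·√m·(C∕ξ)e^{ηC∕ξ}`,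
`q = κ_e·2√m·√m·(C∕ξ²)e^{ηC∕ξ}`. [cite: Balaban1985BackgroundPropagators, (3.35) p.396, (3.51)–(3.52) p.400] -/
theorem sf_localCoefLetters (he : ∀ A B : Matrix mm mm ℂ, traceForm A B = e A ⬝ᵥ e B) {η : ℝ} (hη : 0 < η) {ξ C : ℝ} (hξ : 0 < ξ) (hC : 0 ≤ C)
    {A : J → X → Matrix mm mm ℂ} (hA : ∀ μ x, (A μ x)ᴴ = A μ x) (hA1 : ∀ μ x, ‖A μ x‖ < C * ξ⁻¹)
    (hA2 : ∀ μ ν x, ‖((η : ℂ)⁻¹) • covD τ (fun _ _ => (1 : (Matrix mm mm ℂ)ˣ)) μ (A ν) x‖ < C * (ξ ^ 2)⁻¹) (x : X) :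
    (∀ j' i, ∑ j, |tCoefA η (gaugePair τ fun μ y => coordMat e (ContinuousLinearMap.mulLeftRight ℝ (Matrix mm mm ℂ) ((1 : Matrix mm mm ℂ) * (fluct η A μ y : Matrix mm mm ℂ) * (1 : Matrix mm mm ℂ)ᴴ)
          ((1 : Matrix mm mm ℂ) * (fluct η A μ y : Matrix mm mm ℂ) * (1 : Matrix mm mm ℂ)ᴴ)ᴴ)) j' x i j| ≤
        Fintype.card ι * (@basisConst ι _ (Matrix mm mm ℂ) Matrix.frobeniusNormedAddCommGroup Matrix.frobeniusNormedSpace e * (2 * Real.sqrt (Fintype.card mm)) *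
          (Real.sqrt (Fintype.card mm) * ((C / ξ) * Real.exp (η * (C / ξ)))))) ∧
      ∀ i, ∑ j, |tCoefC η (gaugePair τ fun μ y => coordMat e (ContinuousLinearMap.mulLeftRight ℝ (Matrix mm mm ℂ) ((1 : Matrix mm mm ℂ) * (fluct η A μ y : Matrix mm mm ℂ) * (1 : Matrix mm mm ℂ)ᴴ)
          ((1 : Matrix mm mm ℂ) * (fluct η A μ y : Matrix mm mm ℂ) * (1 : Matrix mm mm ℂ)ᴴ)ᴴ)) x i j| ≤
        Fintype.card ι * (Fintype.card J *
          (Fintype.card ι * (@basisConst ι _ (Matrix mm mm ℂ) Matrix.frobeniusNormedAddCommGroup Matrix.frobeniusNormedSpace e * (2 * Real.sqrt (Fintype.card mm)) *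
              (Real.sqrt (Fintype.card mm) * ((C / ξ) * Real.exp (η * (C / ξ))))) ^ 2 +
            @basisConst ι _ (Matrix mm mm ℂ) Matrix.frobeniusNormedAddCommGroup Matrix.frobeniusNormedSpace e * (2 * Real.sqrt (Fintype.card mm)) *
              (Real.sqrt (Fintype.card mm) * ((C / ξ ^ 2) * Real.exp (η * (C / ξ)))))) := by
  have hU : ∀ μ y, (fluct η A μ y : Matrix mm mm ℂ) ∈ Matrix.unitaryGroup mm ℂ := fluct_mem_unitaryGroup_of_isHermitian η hA
  have h := uN_localCoefLetters_of_gauge335 e τ (fluct η A) he hη hU (Q := Set.univ) hξ hC (u := fun _ => 1) (A := A)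
    (fun z _ => ⟨by rw [Units.val_one]; exact norm_one.le, by rw [inv_one, Units.val_one]; exact norm_one.le⟩)
    (fun μ z _ => gaugeTr_one τ (fluct η A) μ z) (fun μ z _ => hA1 μ z) (fun μ ν z _ => hA2 μ ν z)
    (w := fun _ => 1) (fun _ => by rw [Matrix.conjTranspose_one, Matrix.mul_one]) (fun z _ => (Units.val_one).symm) (x := x) (Set.mem_univ x)
    (fun μ => Set.mem_univ _) (fun μ => Set.mem_univ _)
  exact h

end Letters

/-! ## §3 The knit at the cover in the global small-field gauge: every row produced -/

section Knit

open scoped Matrix.Norms.L2Operator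

variable {L : ℕ} [NeZero L]

/-- ★★★ **THE LIVE-BACKGROUND KNIT AT THE COVER IN THE GLOBAL SMALL-FIELD GAUGE, EVERY ROW PRODUCED** (FILE 120 `uN_cvGlued_spec` with `w ≡ 1`, `U := e^{iηA}`, `P := N_L ⊗ 1`, `N_V := 0`,
the (3.35) rows from §2): for odd `L ≥ 7`, `a > 0`, a colour index `ι` there are `δ, w₀, R₀, B > 0` such that on every doubled torus `2L·L^m` of the cover (`k ≥ 1`, `L^m ≥ w₀`), for
trace-form coordinates `e` of `𝔲(m)` (`m ≥ 1`), EVERY HERMITIAN bond field `A` with the GLOBAL (3.35) letters `‖A_μ(x)‖ < C∕ξ`, `‖η⁻¹∇^η_μA_ν(x)‖ < C∕ξ²` (`η = L^{−k}`, `ξ > 0`, `C ≥ 0`)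
whose two explicit row bounds are `≤ r_V` with `r_V(1 + |J ⊕ J|) ≤ R₀`: the glued operator of the dressed smooth-cut Neumann cubes of the cover for the transporters `Ad_{e^{iηA}}` — gauges
`1`, summand `N_L ⊗ 1`, perturbation `0` — is `≤ B·e^{−(δ∕16)|y−y′|_T}` blockwise AND is the two-sided inverse of `Δ_{Ad e^{iηA}} + N_L ⊗ 1`.  No displayed row: the hypothesis is the
small-field class of `A`.  MODEL operator (covariant Laplacian (3.50) ⊗ colour + FLAT nonlocal part (1.69)); MODEL carriers; NOT [B9] Thm 3.1 as printed.
[cite: Balaban1985BackgroundPropagators, Thm 3.1 p.397 (shape: «G(U) … for U satisfying (3.35), M ≥ M₁»), (3.34)–(3.35) p.396, (3.26) p.395, (3.50)–(3.52) p.400, (3.62)–(3.65) pp.402–403; Balaban1984PropagatorsI, (1.69) p.29; Balaban1984PropagatorsII, (2.91)–(2.93) p.239] -/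
theorem sf_cvGlued_spec (hL : Odd L ∧ 1 < L) (hL7 : 7 ≤ L) {a : ℝ} (ha : 0 < a) (ι : Type) [Fintype ι] [DecidableEq ι] :
    ∃ δ w₀ R₀ B : ℝ, 0 < δ ∧ 0 < R₀ ∧ 0 < B ∧
      ∀ (mv kk : ℕ), 1 ≤ kk → w₀ ≤ ((L ^ mv : ℕ) : ℝ) →
      ∀ {mm : Type} [Fintype mm] [DecidableEq mm] [Nonempty mm] (e : Matrix mm mm ℂ ≃L[ℝ] (ι → ℝ)), (∀ A B : Matrix mm mm ℂ, traceForm A B = e A ⬝ᵥ e B) →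
      ∀ (A : Fin (d + 1) → CvX d L mv kk hL → Matrix mm mm ℂ), (∀ μ x, (A μ x)ᴴ = A μ x) →
      ∀ (ξ C : ℝ), 0 < ξ → 0 ≤ C → (∀ μ x, ‖A μ x‖ < C * ξ⁻¹) →
        (∀ μ ν x, ‖((((((L ^ kk : ℕ) : ℝ))⁻¹) : ℝ) : ℂ)⁻¹ • covD (bshiftEquiv (cvM d L mv kk hL) (L ^ kk)) (fun _ _ => (1 : (Matrix mm mm ℂ)ˣ)) μ (A ν) x‖ < C * (ξ ^ 2)⁻¹) →
      ∀ (rV : ℝ), 0 ≤ rV →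
        Fintype.card ι * (@basisConst ι _ (Matrix mm mm ℂ) Matrix.frobeniusNormedAddCommGroup Matrix.frobeniusNormedSpace e * (2 * Real.sqrt (Fintype.card mm)) * (Real.sqrt (Fintype.card mm) * ((C / ξ) * Real.exp (((((L ^ kk : ℕ) : ℝ))⁻¹) * (C / ξ))))) ≤ rV →
        Fintype.card ι * (Fintype.card (Fin (d + 1)) * (Fintype.card ι * (@basisConst ι _ (Matrix mm mm ℂ) Matrix.frobeniusNormedAddCommGroup Matrix.frobeniusNormedSpace e * (2 * Real.sqrt (Fintype.card mm)) * (Real.sqrt (Fintype.card mm) * ((C / ξ) * Real.exp (((((L ^ kk : ℕ) : ℝ))⁻¹) * (C / ξ))))) ^ 2 + @basisConst ι _ (Matrix mm mm ℂ) Matrix.frobeniusNormedAddCommGroup Matrix.frobeniusNormedSpace e * (2 * Real.sqrt (Fintype.card mm)) * (Real.sqrt (Fintype.card mm) * ((C / ξ ^ 2) * Real.exp (((((L ^ kk : ℕ) : ℝ))⁻¹) * (C / ξ)))))) ≤ rV →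
        rV * (1 + Fintype.card (Fin (d + 1) ⊕ Fin (d + 1))) ≤ R₀ →
                HasMaj (CvNorm d L mv kk hL ι) (CvNorm d L mv kk hL ι) (cvGlued d L mv kk hL a ((((L ^ kk : ℕ) : ℝ))⁻¹) ι e (fun _ _ => (1 : Matrix mm mm ℂ)) (fun μ x => (fluct ((((L ^ kk : ℕ) : ℝ))⁻¹) A μ x : Matrix mm mm ℂ)) (cvNL d L mv kk hL a ι) (fun _ => 0))
          (fun y y' => B * Real.exp (-(δ / 16 * (unitTorusGeo L kk (cvM d L mv kk hL)).dist y y'))) ∧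
        (cvGlued d L mv kk hL a ((((L ^ kk : ℕ) : ℝ))⁻¹) ι e (fun _ _ => (1 : Matrix mm mm ℂ)) (fun μ x => (fluct ((((L ^ kk : ℕ) : ℝ))⁻¹) A μ x : Matrix mm mm ℂ)) (cvNL d L mv kk hL a ι) (fun _ => 0) ∘ₗ (covLapM (bshiftEquiv (cvM d L mv kk hL) (L ^ kk)) ((((L ^ kk : ℕ) : ℝ))⁻¹) (gaugePair (bshiftEquiv (cvM d L mv kk hL) (L ^ kk)) (fun μ x => coordMat e (ContinuousLinearMap.mulLeftRight ℝ (Matrix mm mm ℂ) (fluct ((((L ^ kk : ℕ) : ℝ))⁻¹) A μ x : Matrix mm mm ℂ) (fluct ((((L ^ kk : ℕ) : ℝ))⁻¹) A μ x : Matrix mm mm ℂ)ᴴ))) + cvNL d L mv kk hL a ι) = LinearMap.id ∧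
          (covLapM (bshiftEquiv (cvM d L mv kk hL) (L ^ kk)) ((((L ^ kk : ℕ) : ℝ))⁻¹) (gaugePair (bshiftEquiv (cvM d L mv kk hL) (L ^ kk)) (fun μ x => coordMat e (ContinuousLinearMap.mulLeftRight ℝ (Matrix mm mm ℂ) (fluct ((((L ^ kk : ℕ) : ℝ))⁻¹) A μ x : Matrix mm mm ℂ) (fluct ((((L ^ kk : ℕ) : ℝ))⁻¹) A μ x : Matrix mm mm ℂ)ᴴ))) + cvNL d L mv kk hL a ι) ∘ₗ cvGlued d L mv kk hL a ((((L ^ kk : ℕ) : ℝ))⁻¹) ι e (fun _ _ => (1 : Matrix mm mm ℂ)) (fun μ x => (fluct ((((L ^ kk : ℕ) : ℝ))⁻¹) A μ x : Matrix mm mm ℂ)) (cvNL d L mv kk hL a ι) (fun _ => 0) = LinearMap.id) := by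
  obtain ⟨δ, w₀, R₀, θ₀, B, hδ, hR₀, hθ₀, hB, H⟩ := uN_cvGlued_spec (d := d) hL hL7 ha ι
  refine ⟨δ, w₀, R₀, B, hδ, hR₀, hB, fun mv kk hk hw₀ => ?_⟩
  intro mm _ _ _ e he A hA ξ C hξ hC hA1 hA2 rV hrV hrA hrC hRle
  have hη : (0 : ℝ) < ((((L ^ kk : ℕ) : ℝ))⁻¹) := inv_pos.mpr (Nat.cast_pos.mpr (pow_pos (Nat.pos_of_ne_zero (NeZero.ne L)) kk))
  have hlet := fun x => sf_localCoefLetters e (bshiftEquiv (cvM d L mv kk hL) (L ^ kk)) he hη hξ hC hA hA1 hA2 x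
  exact H mv kk hk hw₀ e he (fun _ _ => 1) (fun _ _ => by rw [Matrix.conjTranspose_one, Matrix.mul_one]) (fun μ x => (fluct ((((L ^ kk : ℕ) : ℝ))⁻¹) A μ x : Matrix mm mm ℂ))
    (cvNL d L mv kk hL a ι) (fun _ => 0) rV 0 0 hrV le_rfl le_rfl (by rw [add_zero]; exact hRle) hθ₀.le (fun k => conj_one_eq_sub_zero e (cvNL d L mv kk hL a ι))
    (fun k x _ i => ((hlet x).2 i).trans hrC) (fun k j' x _ i => ((hlet x).1 j' i).trans hrA)
    (fun k => hasMaj_sandwich_zero _ _ _ _ le_rfl _) (fun k => hasMaj_sandwich_zero _ _ _ _ le_rfl _)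

/-- ★★★ **THE SAME ON THE FINE GRID OF THE COVER** (FILE 124 `uN_cvGlued'_spec` with `w ≡ 1`, `U := e^{iη′A}`, `P := N_L′ ⊗ 1`, `N_V := 0`; spacing `η′ = (L^rL^k)^{−1}`, blocks and
decay read on the COARSE unit lattice, constants uniform in the refinement `r`).  MODEL operator ∕ carriers; NOT [B9] Thm 3.1 as printed.
[cite: Balaban1985BackgroundPropagators, Thm 3.1 p.397 (shape), (3.34)–(3.35) p.396, (3.50)–(3.52) p.400; Balaban1984PropagatorsI, (1.69) p.29; Balaban1984PropagatorsII, (2.91)–(2.93) p.239] -/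
theorem sf_cvGlued'_spec (hL : Odd L ∧ 1 < L) (hL7 : 7 ≤ L) {a : ℝ} (ha : 0 < a) (ι : Type) [Fintype ι] [DecidableEq ι] :
    ∃ δ w₀ R₀ B : ℝ, 0 < δ ∧ 0 < R₀ ∧ 0 < B ∧
      ∀ (mv kk r : ℕ), 1 ≤ kk → w₀ ≤ ((L ^ mv : ℕ) : ℝ) →
      ∀ {mm : Type} [Fintype mm] [DecidableEq mm] [Nonempty mm] (e : Matrix mm mm ℂ ≃L[ℝ] (ι → ℝ)), (∀ A B : Matrix mm mm ℂ, traceForm A B = e A ⬝ᵥ e B) →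
      ∀ (A : Fin (d + 1) → CvX' d L mv kk r hL → Matrix mm mm ℂ), (∀ μ x, (A μ x)ᴴ = A μ x) →
      ∀ (ξ C : ℝ), 0 < ξ → 0 ≤ C → (∀ μ x, ‖A μ x‖ < C * ξ⁻¹) →
        (∀ μ ν x, ‖((((((L ^ r * L ^ kk : ℕ) : ℝ))⁻¹) : ℝ) : ℂ)⁻¹ • covD (bshiftEquiv (cvM d L mv kk hL) (L ^ r * L ^ kk)) (fun _ _ => (1 : (Matrix mm mm ℂ)ˣ)) μ (A ν) x‖ < C * (ξ ^ 2)⁻¹) →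
      ∀ (rV : ℝ), 0 ≤ rV →
        Fintype.card ι * (@basisConst ι _ (Matrix mm mm ℂ) Matrix.frobeniusNormedAddCommGroup Matrix.frobeniusNormedSpace e * (2 * Real.sqrt (Fintype.card mm)) * (Real.sqrt (Fintype.card mm) * ((C / ξ) * Real.exp (((((L ^ r * L ^ kk : ℕ) : ℝ))⁻¹) * (C / ξ))))) ≤ rV →
        Fintype.card ι * (Fintype.card (Fin (d + 1)) * (Fintype.card ι * (@basisConst ι _ (Matrix mm mm ℂ) Matrix.frobeniusNormedAddCommGroup Matrix.frobeniusNormedSpace e * (2 * Real.sqrt (Fintype.card mm)) * (Real.sqrt (Fintype.card mm) * ((C / ξ) * Real.exp (((((L ^ r * L ^ kk : ℕ) : ℝ))⁻¹) * (C / ξ))))) ^ 2 + @basisConst ι _ (Matrix mm mm ℂ) Matrix.frobeniusNormedAddCommGroup Matrix.frobeniusNormedSpace e * (2 * Real.sqrt (Fintype.card mm)) * (Real.sqrt (Fintype.card mm) * ((C / ξ ^ 2) * Real.exp (((((L ^ r * L ^ kk : ℕ) : ℝ))⁻¹) * (C / ξ)))))) ≤ rV →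
        rV * (1 + Fintype.card (Fin (d + 1) ⊕ Fin (d + 1))) ≤ R₀ →
                HasMaj (BlockNorm.ofBlocks (unitTorusGeo L kk (cvM d L mv kk hL)) (liftBlk (fun b : CvX' d L mv kk r hL => blockOf (L ^ r * L ^ kk) (cvM d L mv kk hL) b.1) ι)) (BlockNorm.ofBlocks (unitTorusGeo L kk (cvM d L mv kk hL)) (liftBlk (fun b : CvX' d L mv kk r hL => blockOf (L ^ r * L ^ kk) (cvM d L mv kk hL) b.1) ι)) (cvGlued' d L mv kk r hL a ((((L ^ r * L ^ kk : ℕ) : ℝ))⁻¹) ι e (fun _ _ => (1 : Matrix mm mm ℂ)) (fun μ x => (fluct ((((L ^ r * L ^ kk : ℕ) : ℝ))⁻¹) A μ x : Matrix mm mm ℂ)) (cvNL' d L mv kk r hL a ι) (fun _ => 0))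
          (fun y y' => B * Real.exp (-(δ / 16 * (unitTorusGeo L kk (cvM d L mv kk hL)).dist y y'))) ∧
        (cvGlued' d L mv kk r hL a ((((L ^ r * L ^ kk : ℕ) : ℝ))⁻¹) ι e (fun _ _ => (1 : Matrix mm mm ℂ)) (fun μ x => (fluct ((((L ^ r * L ^ kk : ℕ) : ℝ))⁻¹) A μ x : Matrix mm mm ℂ)) (cvNL' d L mv kk r hL a ι) (fun _ => 0) ∘ₗ (covLapM (bshiftEquiv (cvM d L mv kk hL) (L ^ r * L ^ kk)) ((((L ^ r * L ^ kk : ℕ) : ℝ))⁻¹) (gaugePair (bshiftEquiv (cvM d L mv kk hL) (L ^ r * L ^ kk)) (fun μ x => coordMat e (ContinuousLinearMap.mulLeftRight ℝ (Matrix mm mm ℂ) (fluct ((((L ^ r * L ^ kk : ℕ) : ℝ))⁻¹) A μ x : Matrix mm mm ℂ) (fluct ((((L ^ r * L ^ kk : ℕ) : ℝ))⁻¹) A μ x : Matrix mm mm ℂ)ᴴ))) + cvNL' d L mv kk r hL a ι) = LinearMap.id ∧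
          (covLapM (bshiftEquiv (cvM d L mv kk hL) (L ^ r * L ^ kk)) ((((L ^ r * L ^ kk : ℕ) : ℝ))⁻¹) (gaugePair (bshiftEquiv (cvM d L mv kk hL) (L ^ r * L ^ kk)) (fun μ x => coordMat e (ContinuousLinearMap.mulLeftRight ℝ (Matrix mm mm ℂ) (fluct ((((L ^ r * L ^ kk : ℕ) : ℝ))⁻¹) A μ x : Matrix mm mm ℂ) (fluct ((((L ^ r * L ^ kk : ℕ) : ℝ))⁻¹) A μ x : Matrix mm mm ℂ)ᴴ))) + cvNL' d L mv kk r hL a ι) ∘ₗ cvGlued' d L mv kk r hL a ((((L ^ r * L ^ kk : ℕ) : ℝ))⁻¹) ι e (fun _ _ => (1 : Matrix mm mm ℂ)) (fun μ x => (fluct ((((L ^ r * L ^ kk : ℕ) : ℝ))⁻¹) A μ x : Matrix mm mm ℂ)) (cvNL' d L mv kk r hL a ι) (fun _ => 0) = LinearMap.id) := by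
  obtain ⟨δ, w₀, R₀, θ₀, B, hδ, hR₀, hθ₀, hB, H⟩ := uN_cvGlued'_spec (d := d) hL hL7 ha ι
  refine ⟨δ, w₀, R₀, B, hδ, hR₀, hB, fun mv kk r hk hw₀ => ?_⟩
  intro mm _ _ _ e he A hA ξ C hξ hC hA1 hA2 rV hrV hrA hrC hRle
  have hη : (0 : ℝ) < ((((L ^ r * L ^ kk : ℕ) : ℝ))⁻¹) :=
    inv_pos.mpr (Nat.cast_pos.mpr (Nat.mul_pos (pow_pos (Nat.pos_of_ne_zero (NeZero.ne L)) r) (pow_pos (Nat.pos_of_ne_zero (NeZero.ne L)) kk)))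
  have hlet := fun x => sf_localCoefLetters e (bshiftEquiv (cvM d L mv kk hL) (L ^ r * L ^ kk)) he hη hξ hC hA hA1 hA2 x
  exact H mv kk r hk hw₀ e he (fun _ _ => 1) (fun _ _ => by rw [Matrix.conjTranspose_one, Matrix.mul_one]) (fun μ x => (fluct ((((L ^ r * L ^ kk : ℕ) : ℝ))⁻¹) A μ x : Matrix mm mm ℂ))
    (cvNL' d L mv kk r hL a ι) (fun _ => 0) rV 0 0 hrV le_rfl le_rfl (by rw [add_zero]; exact hRle) hθ₀.le (fun k => conj_one_eq_sub_zero e (cvNL' d L mv kk r hL a ι))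
    (fun k x _ i => ((hlet x).2 i).trans hrC) (fun k j' x _ i => ((hlet x).1 j' i).trans hrA)
    (fun k => hasMaj_sandwich_zero _ _ _ _ le_rfl _) (fun k => hasMaj_sandwich_zero _ _ _ _ le_rfl _)

end Knit

end Summit.QuantumFields.YangMills.BalabanUVNodes.N15.Gluing

end
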